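import Literature.Analysis.SpecialFunctions.SpheroidalHarmonicEigenfunction
import Mathlib.MeasureTheory.Integral.IntervalIntegral.FundThmCalculus
import Mathlib.Analysis.SpecialFunctions.Integrals.Basic
import HarnessLib

/-!
# The spheroidal shooting function: parameter derivatives, the differentiated equation, and
# Green's identity (`∂F/∂ν ≠ 0` at real zeros; `0 ≤ ∂F/∂κ / ∂F/∂ν ≤ 1`)

Topic `Literature/Analysis/SpecialFunctions` (namespace `Literature.Analysis.SpecialFunctions`),
continuing `SpheroidalHarmonicSeries.lean` / `SpheroidalHarmonicEigenfunction.lean`. For the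
Frobenius solution `q(t; m, ν, κ) = Σ cₖ tᵏ` of the `m`-spheroidal equation
`t(2 − t) q'' + 2(m+1)(1 − t) q' + (ν + κ(1 − t)²) q = 0` and its **shooting function**
`F(ν, κ) = q'(1; m, ν, κ)` (`sphmShoot`; zeros of `F` ↔ even eigenfunctions regular at both poles),
this file proves the identities behind Shlapentokh-Rothman's App. B (Prop. B.1: the eigenvalues
continue holomorphically in `κ`; Prop. B.3: `∂λ/∂μ > 0`), at the level of the explicit series:

* the parameter derivative `∂ᵥq` in a direction `v = (v₁, v₂)` of the `(ν, κ)`-plane, realised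
  through the derivative of the smooth coefficient map `p ↦ (cₖ(p)(5/4)ᵏ)ₖ ∈ ℕ →ᵇ ℂ`
  (`sphmDq`, `sphmDq'`, `sphmDq''`, with `fderiv_sphmFun_apply`, `fderiv_sphmShoot_apply`), and the
  **differentiated equation** `t(2−t) (∂ᵥq)'' + 2(m+1)(1−t)(∂ᵥq)' + (ν + κ(1−t)²) ∂ᵥq
  = −(v₁ + v₂(1−t)²) q` (`sphmDq_ode`);
* **Green's identity** on `[0, 1]` for the pair `(q, ∂ᵥq)` with the weight `w = (t(2−t))^m`,
  `p = (t(2−t))^{m+1}` (`p(0) = 0`, `p(1) = 1`):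
  `q(1) ∂ᵥF − ∂ᵥq(1) F = −∫₀¹ (t(2−t))^m (v₁ + v₂(1−t)²) q(t)² dt` (`sphm_green`);
* consequences at a **real zero** `F(ν, κ) = 0`, `ν, κ ∈ ℝ`: `q(1) ∂F/∂ν = −∫₀¹ w q² < 0`, so
  `∂F/∂ν ≠ 0` and `q(1) ≠ 0` (`sphmShoot_dnu_ne_zero`), and
  `q(1) ∂F/∂κ = −∫₀¹ w (1−t)² q²`, whence `0 ≤ (∂F/∂κ)/(∂F/∂ν) ≤ 1` (`sphmShoot_ratio_mem`) —
  the Hellmann–Feynman inequality `−1 ≤ dν/dκ ≤ 0` along eigenvalue branches.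

## References
* Y. Shlapentokh-Rothman, Comm. Math. Phys. 329 (2014) 859–891, App. B, Props. B.1 and B.3
  (Props. 8.1, 8.3 of the held copy `paper:arxiv-1302.3448`). Key `ShlapentokhRothman2014KleinGordon`.
* P. Hartman, *Ordinary Differential Equations*, SIAM Classics 38 (2002), Ch. XI §4 (Green's
  identity for Sturm–Liouville operators). Key `Hartman2002`.
-/

noncomputable section

open Set Filter Metric intervalIntegral
open scoped Topology ContDiff

namespace Literature.Analysis.SpecialFunctions

open Literature.Analysis.ODE

/-! ### The shooting function and the parameter derivative of the coefficient map -/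

section ParamDeriv

variable (m : ℕ)

/-- **The shooting function** `F(ν, κ) = q'(t = 1; m, ν, κ)` (the derivative at the equator of the
solution regular at the pole; its zeros are the parameters of even eigenfunctions regular at both
poles, `SpheroidalHarmonicEigenfunction.lean`). [cite: ShlapentokhRothman2014KleinGordon, App. B] -/
def sphmShoot (p : ℂ × ℂ) : ℂ := sphmDer m p.1 p.2 1

/-- The directional derivative, in the direction `v` of the parameter plane, of the evaluation
coefficient sequence `p ↦ (cₖ(p) (5/4)ᵏ)ₖ ∈ ℕ →ᵇ ℂ` (with the exponent `N(m, R)` of the parameter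
disc `‖ν‖ + ‖κ‖ < R`). [folklore] -/
def sphmDSeq (R : ℝ) (p v : ℂ × ℂ) : CSeq := fderiv ℂ (sphmEvalSeq m (sphmN m R)) p v

/-- The parameter derivative `∂ᵥ q(t; p)` as a function of complex `t`. [folklore] -/
def sphmDq (R : ℝ) (p v : ℂ × ℂ) (t : ℂ) : ℂ := evCLM 0 ((4 / 5 : ℂ) * t) (sphmDSeq m R p v)

/-- Its first `t`-derivative `∂ₜ ∂ᵥ q`. [folklore] -/
def sphmDq' (R : ℝ) (p v : ℂ × ℂ) (t : ℂ) : ℂ := 4 / 5 * evCLM 1 ((4 / 5 : ℂ) * t) (sphmDSeq m R p v)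

/-- Its second `t`-derivative `∂ₜ² ∂ᵥ q`. [folklore] -/
def sphmDq'' (R : ℝ) (p v : ℂ × ℂ) (t : ℂ) : ℂ := (4 / 5) ^ 2 * evCLM 2 ((4 / 5 : ℂ) * t) (sphmDSeq m R p v)

variable {m}

/-- `F` is smooth (entire in `(ν, κ)`). [cite: ShlapentokhRothman2014KleinGordon, App. B] -/
theorem contDiff_sphmShoot (m : ℕ) {n : WithTop ℕ∞} (hn : n ≤ ∞) : ContDiff ℂ n (sphmShoot m) :=
  contDiff_sphmDer_param m (t₀ := 1) (by norm_num) hn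

/-- The parameter disc `‖ν‖ + ‖κ‖ < R` is a neighbourhood of its points. [folklore] -/
theorem paramDisc_mem_nhds {R : ℝ} {p : ℂ × ℂ} (hp : ‖p.1‖ + ‖p.2‖ < R) :
    {q : ℂ × ℂ | ‖q.1‖ + ‖q.2‖ < R} ∈ 𝓝 p :=
  (isOpen_paramDisc R).mem_nhds hp

/-- The coefficient map is differentiable at points of the disc. [folklore] -/
theorem hasFDerivAt_sphmEvalSeq {R : ℝ} {p : ℂ × ℂ} (hp : ‖p.1‖ + ‖p.2‖ < R) :
    HasFDerivAt (sphmEvalSeq m (sphmN m R)) (fderiv ℂ (sphmEvalSeq m (sphmN m R)) p) p := by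
  have hR : 0 ≤ R := le_of_lt (lt_of_le_of_lt (by positivity) hp)
  exact (((contDiffOn_sphmEvalSeq m R hR (n := 1)).contDiffAt (paramDisc_mem_nhds hp)).differentiableAt
    one_ne_zero).hasFDerivAt

/-- The disc `‖t‖ < 5/4` is a neighbourhood of its points. [folklore] -/
theorem tDisc_mem_nhds {t : ℂ} (ht : ‖t‖ < 5 / 4) : {s : ℂ | ‖s‖ < 5 / 4} ∈ 𝓝 t :=
  (isOpen_lt continuous_norm continuous_const).mem_nhds ht

/-- **`t`-derivative of `∂ᵥq`**: `HasDerivAt (∂ᵥq) (∂ᵥq)' t` on `‖t‖ < 5/4`. [folklore] -/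
theorem hasDerivAt_sphmDq (R : ℝ) (p v : ℂ × ℂ) {t : ℂ} (ht : ‖t‖ < 5 / 4) :
    HasDerivAt (sphmDq m R p v) (sphmDq' m R p v t) t := by
  have hlin : HasDerivAt (fun t : ℂ ↦ (4 / 5 : ℂ) * t) (4 / 5) t := by
    simpa using (hasDerivAt_id t).const_mul (4 / 5 : ℂ)
  have hD : PolyBounded ⇑(sphmDSeq m R p v) := PolyBounded.of_cseq _
  have h := (hasDerivAt_cseries hD (norm_rescale_lt ht)).comp t hlin
  have heq : sphmDq m R p v =ᶠ[𝓝 t] fun t ↦ cseries (⇑(sphmDSeq m R p v)) ((4 / 5 : ℂ) * t) := by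
    filter_upwards [tDisc_mem_nhds ht] with t' ht'
    exact evCLM_zero_apply (norm_rescale_lt ht') _
  refine (h.congr_of_eventuallyEq heq).congr_deriv ?_
  rw [sphmDq', evCLM_one_apply (norm_rescale_lt ht), mul_comm]

/-- **`t`-derivative of `(∂ᵥq)'`**: `HasDerivAt (∂ᵥq)' (∂ᵥq)'' t` on `‖t‖ < 5/4`. [folklore] -/
theorem hasDerivAt_sphmDq' (R : ℝ) (p v : ℂ × ℂ) {t : ℂ} (ht : ‖t‖ < 5 / 4) :
    HasDerivAt (sphmDq' m R p v) (sphmDq'' m R p v t) t := by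
  have hlin : HasDerivAt (fun t : ℂ ↦ (4 / 5 : ℂ) * t) (4 / 5) t := by
    simpa using (hasDerivAt_id t).const_mul (4 / 5 : ℂ)
  have hD : PolyBounded ⇑(sphmDSeq m R p v) := PolyBounded.of_cseq _
  have h := ((hasDerivAt_cseries hD.dSeq (norm_rescale_lt ht)).comp t hlin).const_mul (4 / 5 : ℂ)
  have heq : sphmDq' m R p v =ᶠ[𝓝 t] fun t ↦ (4 / 5 : ℂ) * cseries (dSeq ⇑(sphmDSeq m R p v)) ((4 / 5 : ℂ) * t) := by
    filter_upwards [tDisc_mem_nhds ht] with t' ht'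
    rw [sphmDq', evCLM_one_apply (norm_rescale_lt ht')]
  refine (h.congr_of_eventuallyEq heq).congr_deriv ?_
  rw [sphmDq'', evCLM_two_apply (norm_rescale_lt ht)]
  ring

/-- Near a point of the disc, `q(t; p) = ev₀((4/5)t)(evaluation sequence of p)`. [folklore] -/
theorem sphmFun_eventuallyEq_evCLM {R : ℝ} {p : ℂ × ℂ} (hp : ‖p.1‖ + ‖p.2‖ < R) {t : ℂ}
    (ht : ‖t‖ < 5 / 4) :
    (fun q : ℂ × ℂ ↦ sphmFun m q.1 q.2 t) =ᶠ[𝓝 p]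
      fun q : ℂ × ℂ ↦ evCLM 0 ((4 / 5 : ℂ) * t) (sphmEvalSeq m (sphmN m R) q) := by
  have hR : 0 ≤ R := le_of_lt (lt_of_le_of_lt (by positivity) hp)
  filter_upwards [paramDisc_mem_nhds hp] with q hq
  rw [evCLM_zero_apply (norm_rescale_lt ht), sphmFun_eq_cseries]
  exact cseries_congr (fun k ↦ (sphmEvalSeq_apply m hR (le_of_lt hq) k).symm) _

/-- Near a point of the disc, `q'(t; p) = (4/5) ev₁((4/5)t)(evaluation sequence)`. [folklore] -/
theorem sphmDer_eventuallyEq_evCLM {R : ℝ} {p : ℂ × ℂ} (hp : ‖p.1‖ + ‖p.2‖ < R) {t : ℂ}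
    (ht : ‖t‖ < 5 / 4) :
    (fun q : ℂ × ℂ ↦ sphmDer m q.1 q.2 t) =ᶠ[𝓝 p]
      fun q : ℂ × ℂ ↦ (4 / 5 : ℂ) * evCLM 1 ((4 / 5 : ℂ) * t) (sphmEvalSeq m (sphmN m R) q) := by
  have hR : 0 ≤ R := le_of_lt (lt_of_le_of_lt (by positivity) hp)
  filter_upwards [paramDisc_mem_nhds hp] with q hq
  rw [evCLM_one_apply (norm_rescale_lt ht), sphmDer]
  congr 1
  refine cseries_congr (fun k ↦ ?_) _
  rw [dSeq_apply, dSeq_apply, sphmEvalSeq_apply m hR (le_of_lt hq) (k + 1)]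

/-- Near a point of the disc, `q''(t; p) = (4/5)² ev₂((4/5)t)(evaluation sequence)`. [folklore] -/
theorem sphmDer2_eventuallyEq_evCLM {R : ℝ} {p : ℂ × ℂ} (hp : ‖p.1‖ + ‖p.2‖ < R) {t : ℂ}
    (ht : ‖t‖ < 5 / 4) :
    (fun q : ℂ × ℂ ↦ sphmDer2 m q.1 q.2 t) =ᶠ[𝓝 p]
      fun q : ℂ × ℂ ↦ (4 / 5 : ℂ) ^ 2 * evCLM 2 ((4 / 5 : ℂ) * t) (sphmEvalSeq m (sphmN m R) q) := by
  have hR : 0 ≤ R := le_of_lt (lt_of_le_of_lt (by positivity) hp)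
  filter_upwards [paramDisc_mem_nhds hp] with q hq
  rw [evCLM_two_apply (norm_rescale_lt ht), sphmDer2]
  congr 1
  refine cseries_congr (fun k ↦ ?_) _
  rw [dSeq_apply, dSeq_apply, dSeq_apply, dSeq_apply, sphmEvalSeq_apply m hR (le_of_lt hq) (k + 1 + 1)]

/-- **`fderiv` of `q(t; ·)` in the parameters** at a point of the disc: `∂ᵥ q(t; p) = sphmDq`.
[folklore] -/
theorem hasFDerivAt_sphmFun_param {R : ℝ} {p : ℂ × ℂ} (hp : ‖p.1‖ + ‖p.2‖ < R) {t : ℂ}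
    (ht : ‖t‖ < 5 / 4) :
    HasFDerivAt (fun q : ℂ × ℂ ↦ sphmFun m q.1 q.2 t)
      ((evCLM 0 ((4 / 5 : ℂ) * t)).comp (fderiv ℂ (sphmEvalSeq m (sphmN m R)) p)) p := by
  have h := (evCLM 0 ((4 / 5 : ℂ) * t)).hasFDerivAt.comp p (hasFDerivAt_sphmEvalSeq (m := m) hp)
  exact h.congr_of_eventuallyEq (sphmFun_eventuallyEq_evCLM hp ht)

/-- The same for `q'(t; ·)`. [folklore] -/
theorem hasFDerivAt_sphmDer_param {R : ℝ} {p : ℂ × ℂ} (hp : ‖p.1‖ + ‖p.2‖ < R) {t : ℂ}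
    (ht : ‖t‖ < 5 / 4) :
    HasFDerivAt (fun q : ℂ × ℂ ↦ sphmDer m q.1 q.2 t)
      ((4 / 5 : ℂ) • (evCLM 1 ((4 / 5 : ℂ) * t)).comp (fderiv ℂ (sphmEvalSeq m (sphmN m R)) p)) p := by
  have h := ((evCLM 1 ((4 / 5 : ℂ) * t)).hasFDerivAt.comp p (hasFDerivAt_sphmEvalSeq (m := m) hp)).const_smul
    (4 / 5 : ℂ)
  exact h.congr_of_eventuallyEq ((sphmDer_eventuallyEq_evCLM hp ht).trans (Eventually.of_forall fun q ↦ rfl))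

/-- The same for `q''(t; ·)`. [folklore] -/
theorem hasFDerivAt_sphmDer2_param {R : ℝ} {p : ℂ × ℂ} (hp : ‖p.1‖ + ‖p.2‖ < R) {t : ℂ}
    (ht : ‖t‖ < 5 / 4) :
    HasFDerivAt (fun q : ℂ × ℂ ↦ sphmDer2 m q.1 q.2 t)
      (((4 / 5 : ℂ) ^ 2) • (evCLM 2 ((4 / 5 : ℂ) * t)).comp (fderiv ℂ (sphmEvalSeq m (sphmN m R)) p)) p := by
  have h := ((evCLM 2 ((4 / 5 : ℂ) * t)).hasFDerivAt.comp p (hasFDerivAt_sphmEvalSeq (m := m) hp)).const_smul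
    ((4 / 5 : ℂ) ^ 2)
  exact h.congr_of_eventuallyEq ((sphmDer2_eventuallyEq_evCLM hp ht).trans (Eventually.of_forall fun q ↦ rfl))

/-- `∂ᵥ q(t; p) = sphmDq m R p v t`. [folklore] -/
theorem fderiv_sphmFun_apply {R : ℝ} {p : ℂ × ℂ} (hp : ‖p.1‖ + ‖p.2‖ < R) {t : ℂ} (ht : ‖t‖ < 5 / 4)
    (v : ℂ × ℂ) : fderiv ℂ (fun q : ℂ × ℂ ↦ sphmFun m q.1 q.2 t) p v = sphmDq m R p v t := by
  rw [(hasFDerivAt_sphmFun_param hp ht).fderiv]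
  rfl

/-- `∂ᵥ q'(t; p) = sphmDq' m R p v t`. [folklore] -/
theorem fderiv_sphmDer_apply {R : ℝ} {p : ℂ × ℂ} (hp : ‖p.1‖ + ‖p.2‖ < R) {t : ℂ} (ht : ‖t‖ < 5 / 4)
    (v : ℂ × ℂ) : fderiv ℂ (fun q : ℂ × ℂ ↦ sphmDer m q.1 q.2 t) p v = sphmDq' m R p v t := by
  rw [(hasFDerivAt_sphmDer_param hp ht).fderiv]
  rfl

/-- **`∂ᵥ F(p) = (∂ᵥ q)'(1; p)`**: the derivative of the shooting function is the `t`-derivative at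
the equator of the parameter derivative. [folklore] -/
theorem fderiv_sphmShoot_apply {R : ℝ} {p : ℂ × ℂ} (hp : ‖p.1‖ + ‖p.2‖ < R) (v : ℂ × ℂ) :
    fderiv ℂ (sphmShoot m) p v = sphmDq' m R p v 1 := by
  have h1 : ‖(1 : ℂ)‖ < 5 / 4 := by norm_num
  exact fderiv_sphmDer_apply hp h1 v

/-- **The differentiated equation.** For every direction `v = (v₁, v₂)` and `‖t‖ < 5/4`:
`t(2 − t)(∂ᵥq)'' + 2(m+1)(1 − t)(∂ᵥq)' + (ν + κ(1 − t)²) ∂ᵥq + (v₁ + v₂(1 − t)²) q = 0`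
(differentiate `sphmFun_ode`, valid for all parameters, in the direction `v`).
[cite: ShlapentokhRothman2014KleinGordon, App. B Prop. B.1] -/
theorem sphmDq_ode {R : ℝ} {p : ℂ × ℂ} (hp : ‖p.1‖ + ‖p.2‖ < R) (v : ℂ × ℂ) {t : ℂ} (ht : ‖t‖ < 5 / 4) :
    t * (2 - t) * sphmDq'' m R p v t + 2 * ((m : ℂ) + 1) * (1 - t) * sphmDq' m R p v t +
      (p.1 + p.2 * (1 - t) ^ 2) * sphmDq m R p v t + (v.1 + v.2 * (1 - t) ^ 2) * sphmFun m p.1 p.2 t = 0 := by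
  -- the equation as an identically vanishing function of the parameters
  set G : ℂ × ℂ → ℂ := fun q ↦ t * (2 - t) * sphmDer2 m q.1 q.2 t + 2 * ((m : ℂ) + 1) * (1 - t) * sphmDer m q.1 q.2 t +
    (q.1 + q.2 * (1 - t) ^ 2) * sphmFun m q.1 q.2 t with hG
  have hG0 : G = fun _ ↦ 0 := funext fun q ↦ sphmFun_ode (m := m) (ν := q.1) (κ := q.2) ht
  -- its derivative at `p`
  set D := fderiv ℂ (sphmEvalSeq m (sphmN m R)) p with hD
  have hcoef : HasFDerivAt (fun q : ℂ × ℂ ↦ q.1 + q.2 * (1 - t) ^ 2)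
      (ContinuousLinearMap.fst ℂ ℂ ℂ + ((1 - t) ^ 2) • ContinuousLinearMap.snd ℂ ℂ ℂ) p := by
    have h1 : HasFDerivAt (fun q : ℂ × ℂ ↦ q.1) (ContinuousLinearMap.fst ℂ ℂ ℂ) p := hasFDerivAt_fst
    have h2 : HasFDerivAt (fun q : ℂ × ℂ ↦ q.2 * (1 - t) ^ 2) (((1 - t) ^ 2) • ContinuousLinearMap.snd ℂ ℂ ℂ) p :=
      (hasFDerivAt_snd (𝕜 := ℂ) (E := ℂ) (F := ℂ) (p := p)).mul_const ((1 - t) ^ 2)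
    exact h1.add h2
  have hGd : HasFDerivAt G
      ((t * (2 - t)) • (((4 / 5 : ℂ) ^ 2) • (evCLM 2 ((4 / 5 : ℂ) * t)).comp D) +
        (2 * ((m : ℂ) + 1) * (1 - t)) • ((4 / 5 : ℂ) • (evCLM 1 ((4 / 5 : ℂ) * t)).comp D) +
        ((p.1 + p.2 * (1 - t) ^ 2) • (evCLM 0 ((4 / 5 : ℂ) * t)).comp D +
          (sphmFun m p.1 p.2 t) • (ContinuousLinearMap.fst ℂ ℂ ℂ + ((1 - t) ^ 2) • ContinuousLinearMap.snd ℂ ℂ ℂ))) p := by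
    have h1 := (hasFDerivAt_sphmDer2_param (m := m) hp ht).const_smul (t * (2 - t))
    have h2 := (hasFDerivAt_sphmDer_param (m := m) hp ht).const_smul (2 * ((m : ℂ) + 1) * (1 - t))
    have h3 := hcoef.mul (hasFDerivAt_sphmFun_param (m := m) hp ht)
    have h := (h1.add h2).add h3
    refine h.congr_of_eventuallyEq (Eventually.of_forall fun q ↦ ?_)
    simp only [hG, Pi.add_apply, Pi.smul_apply, Pi.mul_apply, smul_eq_mul]
  -- the derivative of the zero function is zero
  have hzero : (t * (2 - t)) • (((4 / 5 : ℂ) ^ 2) • (evCLM 2 ((4 / 5 : ℂ) * t)).comp D) +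
        (2 * ((m : ℂ) + 1) * (1 - t)) • ((4 / 5 : ℂ) • (evCLM 1 ((4 / 5 : ℂ) * t)).comp D) +
        ((p.1 + p.2 * (1 - t) ^ 2) • (evCLM 0 ((4 / 5 : ℂ) * t)).comp D +
          (sphmFun m p.1 p.2 t) • (ContinuousLinearMap.fst ℂ ℂ ℂ + ((1 - t) ^ 2) • ContinuousLinearMap.snd ℂ ℂ ℂ)) = 0 := by
    have hc : HasFDerivAt G (0 : ℂ × ℂ →L[ℂ] ℂ) p := by rw [hG0]; exact hasFDerivAt_const _ _
    exact hGd.unique hc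
  have happ := congrArg (fun L : ℂ × ℂ →L[ℂ] ℂ ↦ L v) hzero
  simp at happ
  rw [sphmDq'', sphmDq', sphmDq, sphmDSeq, ← hD]
  linear_combination happ

end ParamDeriv

/-! ### Green's identity on `[0, 1]` -/

section Green

variable {m : ℕ} {R : ℝ} {p : ℂ × ℂ} (hp : ‖p.1‖ + ‖p.2‖ < R) (v : ℂ × ℂ)
include hp

omit hp in
/-- Real points of `[0, 1]` (indeed of `(−5/4, 5/4)`) lie in the disc `‖t‖ < 5/4`. [folklore] -/
theorem norm_ofReal_lt_of_abs_lt {t : ℝ} (ht : |t| < 5 / 4) : ‖(t : ℂ)‖ < 5 / 4 := by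
  rwa [Complex.norm_real, Real.norm_eq_abs]

omit hp in
/-- Points of `[0, 1]` have `|t| < 5/4`. [folklore] -/
theorem abs_lt_of_mem_uIcc {t : ℝ} (ht : t ∈ uIcc (0 : ℝ) 1) : |t| < 5 / 4 := by
  rw [uIcc_of_le zero_le_one] at ht
  rw [abs_lt]; constructor <;> linarith [ht.1, ht.2]

/-- **Green's identity for the pair `(q, ∂ᵥq)`** on `[0, 1]`:
`q(1) · ∂ᵥF − ∂ᵥq(1) · F = −∫₀¹ (t(2−t))^m (v₁ + v₂(1−t)²) q(t)² dt`, where `F = q'(1)` is the shooting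
function and `∂ᵥF` its derivative in the direction `v` (the boundary term at the pole `t = 0` vanishes
because `p = (t(2−t))^{m+1}` does; at the equator `p(1) = 1`).
[cite: ShlapentokhRothman2014KleinGordon, App. B Prop. B.1] -/
theorem sphm_green :
    sphmFun m p.1 p.2 1 * fderiv ℂ (sphmShoot m) p v - sphmDq m R p v 1 * sphmShoot m p =
      -∫ t in (0 : ℝ)..1, ((t : ℂ) * (2 - t)) ^ m * (v.1 + v.2 * (1 - (t : ℂ)) ^ 2) * sphmFun m p.1 p.2 t ^ 2 := by
  -- the functions of the real variable
  set qf : ℝ → ℂ := fun t ↦ sphmFun m p.1 p.2 t with hqf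
  set qf' : ℝ → ℂ := fun t ↦ sphmDer m p.1 p.2 t with hqf'
  set qf'' : ℝ → ℂ := fun t ↦ sphmDer2 m p.1 p.2 t with hqf''
  set dq : ℝ → ℂ := fun t ↦ sphmDq m R p v t with hdq
  set dq' : ℝ → ℂ := fun t ↦ sphmDq' m R p v t with hdq'
  set dq'' : ℝ → ℂ := fun t ↦ sphmDq'' m R p v t with hdq''
  set Pf : ℝ → ℂ := fun t ↦ ((t : ℂ) * (2 - t)) ^ (m + 1) with hPf
  set Φ : ℝ → ℂ := fun t ↦ Pf t * (qf t * dq' t - dq t * qf' t) with hΦ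
  set Φ' : ℝ → ℂ := fun t ↦ -(((t : ℂ) * (2 - t)) ^ m * (v.1 + v.2 * (1 - (t : ℂ)) ^ 2) * qf t ^ 2) with hΦ'
  -- derivatives at real points with `|t| < 5/4`
  have hder : ∀ t : ℝ, |t| < 5 / 4 → HasDerivAt Φ (Φ' t) t := by
    intro t ht
    have htc : ‖(t : ℂ)‖ < 5 / 4 := norm_ofReal_lt_of_abs_lt ht
    have h1 : HasDerivAt qf (qf' t) t := (hasDerivAt_sphmFun (m := m) (ν := p.1) (κ := p.2) htc).comp_ofReal
    have h2 : HasDerivAt qf' (qf'' t) t := (hasDerivAt_sphmDer (m := m) (ν := p.1) (κ := p.2) htc).comp_ofReal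
    have h3 : HasDerivAt dq (dq' t) t := (hasDerivAt_sphmDq (m := m) R p v htc).comp_ofReal
    have h4 : HasDerivAt dq' (dq'' t) t := (hasDerivAt_sphmDq' (m := m) R p v htc).comp_ofReal
    have hbase : HasDerivAt (fun s : ℝ ↦ (s : ℂ) * (2 - s)) (2 - 2 * (t : ℂ)) t := by
      have ho := Complex.ofRealCLM.hasDerivAt (x := t)
      have := ho.mul ((hasDerivAt_const t (2 : ℂ)).sub ho)
      refine this.congr_deriv ?_
      simp; ring
    have hP : HasDerivAt Pf (((m : ℂ) + 1) * ((t : ℂ) * (2 - t)) ^ m * (2 - 2 * (t : ℂ))) t := by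
      have := hbase.pow (m + 1)
      refine this.congr_deriv ?_
      push_cast; ring_nf
    have hprod := hP.mul ((h1.mul h4).sub (h3.mul h2))
    refine hprod.congr_deriv ?_
    -- the two differential equations at `t`
    have ode1 := sphmFun_ode (m := m) (ν := p.1) (κ := p.2) htc
    have ode2 := sphmDq_ode (m := m) hp v htc
    simp only [hqf, hqf', hqf'', hdq, hdq', hdq'', hPf, hΦ', Pi.mul_apply, Pi.sub_apply]
    linear_combination (((t : ℂ) * (2 - t)) ^ m * sphmFun m p.1 p.2 t) * ode2 -
      (((t : ℂ) * (2 - t)) ^ m * sphmDq m R p v t) * ode1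
  -- the fundamental theorem of calculus on `[0, 1]`
  have hcont : ContinuousOn Φ' (uIcc (0 : ℝ) 1) := by
    have hq : ∀ t ∈ uIcc (0 : ℝ) 1, ContinuousAt qf t := fun t ht ↦
      ((hasDerivAt_sphmFun (m := m) (ν := p.1) (κ := p.2)
        (norm_ofReal_lt_of_abs_lt (abs_lt_of_mem_uIcc ht))).comp_ofReal).continuousAt
    intro t ht
    refine ContinuousAt.continuousWithinAt ?_
    simp only [hΦ']
    have hc : ContinuousAt (fun s : ℝ ↦ (s : ℂ)) t := Complex.continuous_ofReal.continuousAt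
    exact ((((hc.mul (continuousAt_const.sub hc)).pow m).mul
      (continuousAt_const.add (continuousAt_const.mul ((continuousAt_const.sub hc).pow 2)))).mul
        ((hq t ht).pow 2)).neg
  have hftc := integral_eq_sub_of_hasDerivAt (fun t ht ↦ hder t (abs_lt_of_mem_uIcc ht))
    (hcont.intervalIntegrable)
  -- evaluate the boundary terms
  have hΦ0 : Φ 0 = 0 := by simp [hΦ, hPf]
  have hΦ1 : Φ 1 = sphmFun m p.1 p.2 1 * fderiv ℂ (sphmShoot m) p v - sphmDq m R p v 1 * sphmShoot m p := by
    simp only [hΦ, hPf, hqf, hqf', hdq, hdq', Complex.ofReal_one, sphmShoot]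
    rw [fderiv_sphmShoot_apply hp v]
    norm_num
  rw [hΦ0, hΦ1, sub_zero] at hftc
  rw [← hftc]
  simp only [hΦ', hqf, intervalIntegral.integral_neg]

end Green

/-! ### Consequences at a real zero of the shooting function -/

section RealZero

variable {m : ℕ} {ν κ : ℂ} (hν : ν.im = 0) (hκ : κ.im = 0)
include hν hκ

/-- For real parameters, `q(t)` is the complex number attached to the real number `re q(t)`
(real `t`, `|t| < 5/4`). [folklore] -/
theorem sphmFun_ofReal_eq_re {t : ℝ} (ht : |t| < 5 / 4) :
    sphmFun m ν κ (t : ℂ) = ((sphmFun m ν κ (t : ℂ)).re : ℂ) := by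
  conv_lhs => rw [← Complex.re_add_im (sphmFun m ν κ (t : ℂ)), im_sphmFun_ofReal (m := m) hν hκ ht]
  simp

/-- The Green integrand for real parameters and real direction `(v₁, v₂)`, as a real function:
`(t(2−t))^m (v₁ + v₂(1−t)²) (re q(t))²`. [folklore] -/
theorem green_integrand_ofReal (v₁ v₂ : ℝ) {t : ℝ} (ht : |t| < 5 / 4) :
    ((t : ℂ) * (2 - t)) ^ m * ((v₁ : ℂ) + (v₂ : ℂ) * (1 - (t : ℂ)) ^ 2) * sphmFun m ν κ t ^ 2 =
      (((t * (2 - t)) ^ m * (v₁ + v₂ * (1 - t) ^ 2) * (sphmFun m ν κ (t : ℂ)).re ^ 2 : ℝ) : ℂ) := by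
  conv_lhs => rw [sphmFun_ofReal_eq_re hν hκ ht]
  push_cast
  ring

omit hν hκ in
/-- **The `ν`-integral is positive**: `∫₀¹ (t(2−t))^m (re q(t))² dt > 0` (the integrand is
continuous, nonnegative, and positive near `t = 0`, where `q = 1`). [folklore] -/
theorem green_nu_integral_pos :
    0 < ∫ t in (0 : ℝ)..1, (t * (2 - t)) ^ m * (sphmFun m ν κ (t : ℂ)).re ^ 2 := by
  set g : ℝ → ℝ := fun t ↦ (t * (2 - t)) ^ m * (sphmFun m ν κ (t : ℂ)).re ^ 2 with hg
  -- continuity of `t ↦ re q(t)` on `[0, 1]` (indeed on `|t| < 5/4`)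
  have hq : ∀ t : ℝ, |t| < 5 / 4 → ContinuousAt (fun s : ℝ ↦ (sphmFun m ν κ (s : ℂ)).re) t := fun t ht ↦
    Complex.continuous_re.continuousAt.comp
      ((hasDerivAt_sphmFun (m := m) (ν := ν) (κ := κ)
        (by rwa [Complex.norm_real, Real.norm_eq_abs])).comp_ofReal).continuousAt
  have hgc : ∀ t : ℝ, |t| < 5 / 4 → ContinuousAt g t := fun t ht ↦
    ((continuousAt_id.mul (continuousAt_const.sub continuousAt_id)).pow m).mul ((hq t ht).pow 2)
  have hgi : ∀ a b : ℝ, uIcc a b ⊆ Icc 0 1 → IntervalIntegrable g MeasureTheory.volume a b := fun a b hab ↦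
    ContinuousOn.intervalIntegrable fun t ht ↦ (hgc t (by
      have := hab ht; rw [abs_lt]; constructor <;> linarith [this.1, this.2])).continuousWithinAt
  have hg_nonneg : ∀ t ∈ Icc (0 : ℝ) 1, 0 ≤ g t := fun t ht ↦ by
    simp only [hg]
    exact mul_nonneg (pow_nonneg (mul_nonneg ht.1 (by linarith [ht.2])) m) (sq_nonneg _)
  -- positivity near `0`: `re q(0) = 1`, so `re q > 1/2` on `[0, δ)`
  have h0 : (sphmFun m ν κ ((0 : ℝ) : ℂ)).re = 1 := by
    rw [Complex.ofReal_zero, sphmFun_zero]; simp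
  obtain ⟨δ, hδ, hδq⟩ : ∃ δ > 0, ∀ t : ℝ, |t| < δ → 1 / 2 < (sphmFun m ν κ (t : ℂ)).re := by
    have hc := hq 0 (by norm_num)
    have hev : ∀ᶠ t : ℝ in 𝓝 0, 1 / 2 < (sphmFun m ν κ (t : ℂ)).re :=
      hc.preimage_mem_nhds (Ioi_mem_nhds (by show 1 / 2 < (sphmFun m ν κ ((0 : ℝ) : ℂ)).re; rw [h0]; norm_num))
    obtain ⟨δ, hδ, hball⟩ := Metric.eventually_nhds_iff.1 hev
    exact ⟨δ, hδ, fun t ht ↦ hball (by simpa [Real.dist_eq] using ht)⟩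
  set δ' : ℝ := min δ 1 with hδ'
  have hδ'0 : 0 < δ' := lt_min hδ zero_lt_one
  have hδ'1 : δ' ≤ 1 := min_le_right _ _
  have hpos : 0 < ∫ t in (0 : ℝ)..δ', g t := by
    refine intervalIntegral_pos_of_pos_on (hgi 0 δ' (by rw [uIcc_of_le hδ'0.le]; exact Icc_subset_Icc_right hδ'1))
      (fun t ht ↦ ?_) hδ'0
    simp only [hg]
    have h1 : 0 < (t * (2 - t)) ^ m := pow_pos (mul_pos ht.1 (by linarith [ht.2, hδ'1])) m
    have h2 : 1 / 2 < (sphmFun m ν κ (t : ℂ)).re :=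
      hδq t (by rw [abs_of_pos ht.1]; exact ht.2.trans_le (min_le_left _ _))
    exact mul_pos h1 (by positivity)
  have hrest : 0 ≤ ∫ t in δ'..1, g t :=
    intervalIntegral.integral_nonneg hδ'1 fun t ht ↦ hg_nonneg t ⟨hδ'0.le.trans ht.1, ht.2⟩
  have hsplit : ∫ t in (0 : ℝ)..1, g t = (∫ t in (0 : ℝ)..δ', g t) + ∫ t in δ'..1, g t :=
    (integral_add_adjacent_intervals (hgi 0 δ' (by rw [uIcc_of_le hδ'0.le]; exact Icc_subset_Icc_right hδ'1))
      (hgi δ' 1 (by rw [uIcc_of_le hδ'1]; exact Icc_subset_Icc_left hδ'0.le))).symm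
  rw [hsplit]
  linarith

/-- **Non-degeneracy of real zeros of the shooting function** (SR App. B, Prop. B.1: "for the sake
of contradiction assume `∂F/∂λ = 0` … `∫|S|² sin θ dθ = 0`"): if `ν, κ` are real and
`F(ν, κ) = 0`, then `∂F/∂ν (ν, κ) ≠ 0`, and moreover `q(1) ≠ 0` with
`q(1) · ∂F/∂ν = −∫₀¹ (t(2−t))^m q² < 0`. [cite: ShlapentokhRothman2014KleinGordon, App. B Prop. B.1] -/
theorem sphmShoot_dnu_ne_zero (hF : sphmShoot m (ν, κ) = 0) :
    fderiv ℂ (sphmShoot m) (ν, κ) (1, 0) ≠ 0 ∧ sphmFun m ν κ 1 ≠ 0 ∧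
      sphmFun m ν κ 1 * fderiv ℂ (sphmShoot m) (ν, κ) (1, 0) =
        -((∫ t in (0 : ℝ)..1, (t * (2 - t)) ^ m * (sphmFun m ν κ (t : ℂ)).re ^ 2 : ℝ) : ℂ) := by
  have hp : ‖((ν, κ) : ℂ × ℂ).1‖ + ‖((ν, κ) : ℂ × ℂ).2‖ < ‖ν‖ + ‖κ‖ + 1 := by simp
  have hg := sphm_green (m := m) hp (1, 0)
  rw [hF, mul_zero, sub_zero] at hg
  have hint : ∫ t in (0 : ℝ)..1, ((t : ℂ) * (2 - t)) ^ m * (((1, 0) : ℂ × ℂ).1 + ((1, 0) : ℂ × ℂ).2 * (1 - (t : ℂ)) ^ 2) *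
      sphmFun m ν κ t ^ 2 = ((∫ t in (0 : ℝ)..1, (t * (2 - t)) ^ m * (sphmFun m ν κ (t : ℂ)).re ^ 2 : ℝ) : ℂ) := by
    rw [← intervalIntegral.integral_ofReal]
    refine intervalIntegral.integral_congr fun t ht ↦ ?_
    have h := green_integrand_ofReal (m := m) hν hκ 1 0 (abs_lt_of_mem_uIcc ht)
    simp only [Complex.ofReal_one, Complex.ofReal_zero] at h
    rw [h]
    push_cast; ring
  simp only at hg
  rw [hint] at hg
  have hpos := green_nu_integral_pos (m := m) (ν := ν) (κ := κ)
  refine ⟨fun h0 ↦ ?_, fun h0 ↦ ?_, hg⟩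
  · rw [h0, mul_zero] at hg
    have := congrArg Complex.re hg
    simp at this
    linarith
  · rw [h0, zero_mul] at hg
    have := congrArg Complex.re hg
    simp at this
    linarith

/-- **The Hellmann–Feynman inequality** (SR App. B, Prop. B.3, `∂λ/∂μ > 0`, in shooting form): at a
real zero of `F`, `∂F/∂κ = r · ∂F/∂ν` with `0 ≤ r ≤ 1`
(`r = ∫₀¹ w (1−t)² q² / ∫₀¹ w q²`, `w = (t(2−t))^m`), so that along an eigenvalue branch
`dν/dκ = −r ∈ [−1, 0]`. [cite: ShlapentokhRothman2014KleinGordon, App. B Prop. B.3] -/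
theorem sphmShoot_ratio_mem (hF : sphmShoot m (ν, κ) = 0) :
    ∃ r : ℝ, 0 ≤ r ∧ r ≤ 1 ∧
      fderiv ℂ (sphmShoot m) (ν, κ) (0, 1) = (r : ℂ) * fderiv ℂ (sphmShoot m) (ν, κ) (1, 0) := by
  have hp : ‖((ν, κ) : ℂ × ℂ).1‖ + ‖((ν, κ) : ℂ × ℂ).2‖ < ‖ν‖ + ‖κ‖ + 1 := by simp
  obtain ⟨hFν, hq1, hJ⟩ := sphmShoot_dnu_ne_zero (m := m) hν hκ hF
  set J : ℝ := ∫ t in (0 : ℝ)..1, (t * (2 - t)) ^ m * (sphmFun m ν κ (t : ℂ)).re ^ 2 with hJ_def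
  set H : ℝ := ∫ t in (0 : ℝ)..1, (t * (2 - t)) ^ m * (1 - t) ^ 2 * (sphmFun m ν κ (t : ℂ)).re ^ 2 with hH_def
  have hJpos : 0 < J := green_nu_integral_pos (m := m) (ν := ν) (κ := κ)
  -- Green with `v = (0, 1)`
  have hg := sphm_green (m := m) hp (0, 1)
  rw [hF, mul_zero, sub_zero] at hg
  have hint : ∫ t in (0 : ℝ)..1, ((t : ℂ) * (2 - t)) ^ m * (((0, 1) : ℂ × ℂ).1 + ((0, 1) : ℂ × ℂ).2 * (1 - (t : ℂ)) ^ 2) *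
      sphmFun m ν κ t ^ 2 = (H : ℂ) := by
    rw [hH_def, ← intervalIntegral.integral_ofReal]
    refine intervalIntegral.integral_congr fun t ht ↦ ?_
    have h := green_integrand_ofReal (m := m) hν hκ 0 1 (abs_lt_of_mem_uIcc ht)
    simp only [Complex.ofReal_one, Complex.ofReal_zero] at h
    rw [h]
    push_cast; ring
  simp only at hg
  rw [hint] at hg
  -- `0 ≤ H ≤ J`
  have hcont : ∀ t : ℝ, |t| < 5 / 4 → ContinuousAt (fun s : ℝ ↦ (sphmFun m ν κ (s : ℂ)).re) t := fun t ht ↦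
    Complex.continuous_re.continuousAt.comp
      ((hasDerivAt_sphmFun (m := m) (ν := ν) (κ := κ)
        (by rwa [Complex.norm_real, Real.norm_eq_abs])).comp_ofReal).continuousAt
  have hH0 : 0 ≤ H := intervalIntegral.integral_nonneg zero_le_one fun t ht ↦ by
    exact mul_nonneg (mul_nonneg (pow_nonneg (mul_nonneg ht.1 (by linarith [ht.2])) m) (sq_nonneg _)) (sq_nonneg _)
  have hHJ : H ≤ J := by
    refine intervalIntegral.integral_mono_on zero_le_one ?_ ?_ fun t ht ↦ ?_
    · refine ContinuousOn.intervalIntegrable fun t ht ↦ ContinuousAt.continuousWithinAt ?_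
      have ht' := abs_lt_of_mem_uIcc ht
      exact (((continuousAt_id.mul (continuousAt_const.sub continuousAt_id)).pow m).mul
        ((continuousAt_const.sub continuousAt_id).pow 2)).mul ((hcont t ht').pow 2)
    · refine ContinuousOn.intervalIntegrable fun t ht ↦ ContinuousAt.continuousWithinAt ?_
      have ht' := abs_lt_of_mem_uIcc ht
      exact ((continuousAt_id.mul (continuousAt_const.sub continuousAt_id)).pow m).mul ((hcont t ht').pow 2)
    · have h1 : (1 - t) ^ 2 ≤ 1 := by nlinarith [ht.1, ht.2]
      have hw : 0 ≤ (t * (2 - t)) ^ m := pow_nonneg (mul_nonneg ht.1 (by linarith [ht.2])) m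
      have hq : 0 ≤ (sphmFun m ν κ (t : ℂ)).re ^ 2 := sq_nonneg _
      calc (t * (2 - t)) ^ m * (1 - t) ^ 2 * (sphmFun m ν κ (t : ℂ)).re ^ 2
          ≤ (t * (2 - t)) ^ m * 1 * (sphmFun m ν κ (t : ℂ)).re ^ 2 := by gcongr
        _ = _ := by ring
  refine ⟨H / J, div_nonneg hH0 hJpos.le, (div_le_one hJpos).2 hHJ, ?_⟩
  -- from `q(1) ∂_νF = −J`, `q(1) ∂_κF = −H`
  have hJne : (J : ℂ) ≠ 0 := by exact_mod_cast hJpos.ne'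
  have e1 : fderiv ℂ (sphmShoot m) (ν, κ) (1, 0) = -(J : ℂ) / sphmFun m ν κ 1 := by
    rw [eq_div_iff hq1, mul_comm]; exact hJ
  have e2 : fderiv ℂ (sphmShoot m) (ν, κ) (0, 1) = -(H : ℂ) / sphmFun m ν κ 1 := by
    rw [eq_div_iff hq1, mul_comm]; exact hg
  rw [e1, e2]
  push_cast
  field_simp

end RealZero

end Literature.Analysis.SpecialFunctions
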